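import Mathlib

/-!
# Tail · box · tail: the matching fixed point (solo-blind, (T2) assembly step (G), PLAN §82)

The canonical landing member (the solution of the n-free inner problem
`α″ = (ξ + M) α`, `M − λ³ M‴ = −(α²)‴` with the live quartic far field at `−∞` and decay at `+∞`)
is certified in three pieces:

* (K) a UNIFORM BOX THEOREM on `[−X₁, X₂]`: for every row perturbation `r` in an admissible set
  `s ⊂ ℝ⁶` (4 left far-field rows, 2 right Robin/F2 rows) interval Krawczyk gives a unique box
  solution, and the map `box : r ↦ observables` (the free data `(c₀, M₂(−X₁))` and the end state
  `(α, M, M₁)(X₂)`) is Lipschitz with an explicit constant `KB` (Neumann bound on `DF⁻¹` over the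
  Krawczyk box);
* (L), (R) TAIL LEMMAS: the solutions on `(−∞, −X₁]` in the asymptotic class, resp. the decaying
  solutions on `[X₂, ∞)`, form graphs over those observables whose states at the matching points
  satisfy the box rows up to a DEFECT `defect : observables → ℝ⁶`, small (values in `s`) and
  Lipschitz with constant `KD`;
* (G) if `KD · KB < 1` the matching equation `defect (box r) = r` has a solution `r⋆ ∈ s`; at `r⋆`
  the three pieces have equal full states at `−X₁` and `X₂`, and `SoloBlindGlue` turns them into one
  global `C¹` solution — the member — carrying every constant certified on the box.

This file proves (G) in the abstract (Banach fixed point on a complete invariant set) and the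
bookkeeping identity "fixed point ⇒ equal states". No ODE theory is used here.
-/

namespace Summit.AnomalousDissipation.AnomalousDissipation.Theorems

open Set Function Metric

/-- **(G), abstract form.** `box : E → O` is Lipschitz with constant `KB` on the admissible row set
`s`, `defect : O → E` is Lipschitz with constant `KD` on `box '' s`, the composite maps `s` into
itself, `s` is complete and nonempty, and `KD * KB < 1`. Then the matching equation
`defect (box r) = r` has a solution in `s`. -/
theorem matching_fixedPoint {E O : Type*} [MetricSpace E] [MetricSpace O]
    {s : Set E} (hs : IsComplete s) (hne : s.Nonempty)
    (box : E → O) (defect : O → E) {KB KD : NNReal}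
    (hbox : LipschitzOnWith KB box s) (hdef : LipschitzOnWith KD defect (box '' s))
    (hmaps : MapsTo (defect ∘ box) s s) (hcontr : KD * KB < 1) :
    ∃ r ∈ s, defect (box r) = r := by
  have hcomp : LipschitzOnWith (KD * KB) (defect ∘ box) s :=
    hdef.comp hbox (mapsTo_image box s)
  obtain ⟨x, hx⟩ := hne
  have hK : ContractingWith (KD * KB) (hmaps.restrict (defect ∘ box) s s) := by
    refine ⟨hcontr, ?_⟩
    rintro ⟨a, ha⟩ ⟨b, hb⟩
    exact hcomp ha hb
  obtain ⟨y, hys, hfix, -⟩ := hK.exists_fixedPoint' hs hmaps hx (edist_ne_top _ _)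
  exact ⟨y, hys, hfix⟩

/-- **(G) on a closed ball.** The form the certificate uses: `E` complete (in practice `ℝ⁶` with a
`ρ`-weighted sup norm), `s = closedBall r₀ ρ`; `box` Lipschitz `KB` on the ball, `defect` Lipschitz
`KD` on its image, `defect ∘ box` maps the ball into itself, `KD * KB < 1` ⇒ a matching point exists
in the ball. -/
theorem matching_fixedPoint_closedBall {E O : Type*} [MetricSpace E] [CompleteSpace E]
    [MetricSpace O] (r₀ : E) {ρ : ℝ} (hρ : 0 ≤ ρ)
    (box : E → O) (defect : O → E) {KB KD : NNReal}
    (hbox : LipschitzOnWith KB box (closedBall r₀ ρ))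
    (hdef : LipschitzOnWith KD defect (box '' closedBall r₀ ρ))
    (hmaps : ∀ r ∈ closedBall r₀ ρ, defect (box r) ∈ closedBall r₀ ρ) (hcontr : KD * KB < 1) :
    ∃ r ∈ closedBall r₀ ρ, defect (box r) = r :=
  matching_fixedPoint isClosed_closedBall.isComplete ⟨r₀, mem_closedBall_self hρ⟩ box defect hbox
    hdef (fun r hr => hmaps r hr) hcontr

/-- **Uniqueness of the matching point** in `s` under the same contraction hypothesis (so the
certified member is THE member of the box, not one of several). -/
theorem matching_fixedPoint_unique {E O : Type*} [MetricSpace E] [MetricSpace O]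
    {s : Set E} (box : E → O) (defect : O → E) {KB KD : NNReal}
    (hbox : LipschitzOnWith KB box s) (hdef : LipschitzOnWith KD defect (box '' s))
    (hcontr : KD * KB < 1) {r₁ r₂ : E} (h₁ : r₁ ∈ s) (h₂ : r₂ ∈ s)
    (hf₁ : defect (box r₁) = r₁) (hf₂ : defect (box r₂) = r₂) : r₁ = r₂ := by
  have hcomp : LipschitzOnWith (KD * KB) (defect ∘ box) s :=
    hdef.comp hbox (mapsTo_image box s)
  have hd : dist r₁ r₂ ≤ (KD * KB : NNReal) * dist r₁ r₂ := by
    have := hcomp.dist_le_mul r₁ h₁ r₂ h₂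
    simpa [Function.comp, hf₁, hf₂] using this
  by_contra hne
  have hpos : 0 < dist r₁ r₂ := dist_pos.mpr hne
  have hlt : ((KD * KB : NNReal) : ℝ) < 1 := by exact_mod_cast hcontr
  nlinarith

/-- **Fixed point ⇒ equal states (bookkeeping).** At a matching point the box piece and a tail
piece have the SAME full state at the matching abscissa. Abstractly: the box state is
`chart p + lift r` (rows = chart of the tail manifold + the row perturbation `r`, with `p = par r` the
free data read off the box solution) and the tail state over the same free data is
`chart p + lift (d p)` (the tail lemma's defect); if `r` agrees with `d (par r)` on the rows that
`lift` sees (`lift r = lift (d (par r))`), the two states coincide. -/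
theorem states_match_of_fixedPoint {E P F : Type*} [AddCommGroup F]
    (chart : P → F) (lift : E → F) (d : P → E) (par : E → P)
    (stateBox : E → F) (stateTail : P → F)
    (hbox : ∀ r, stateBox r = chart (par r) + lift r)
    (htail : ∀ p, stateTail p = chart p + lift (d p))
    {r : E} (hfix : lift r = lift (d (par r))) :
    stateBox r = stateTail (par r) := by
  rw [hbox, htail, hfix]

end Summit.AnomalousDissipation.AnomalousDissipation.Theorems
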